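import Mathlib
import Literature.MathematicalPhysics.QuantumFieldTheory.Balaban1983to89.B10Eq25Rate
import Literature.MathematicalPhysics.QuantumFieldTheory.Balaban1983to89.B10Eq65PolymerSum
import Literature.MathematicalPhysics.QuantumFieldTheory.Balaban1983to89.TreeLengthCubeSystem
import Literature.MathematicalPhysics.QuantumFieldTheory.Balaban1983to89.B13Ineq232

/-!
# `Balaban1983to89.B10Eq25WalkGeometry` — [Balaban1985UV3] p. 262, (23) ⇒ (24)–(25): THE GEOMETRY OF THE LOCALIZATIONS
# «X_m are connected unions of several big blocks», «This localization is simply a union of all these sets», «if the big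
# blocks are scaled to unit cubes» — the walk states, the rescaling law (N), the walk-state adjacency count and the volume
# law CONSTRUCTED AND PROVED on a window of big blocks, so that the cell's kernel edge (23) ⇒ (25) ⇒ (65)₁
# (`B10Eq25Rate.bound25_of_bound23`, `B10Eq65PolymerSum.norm_total_le_of_bound25`) keeps ONE hypothesis: the analytic leaf (23)

T. Bałaban, *Ultraviolet stability of three-dimensional lattice pure gauge field theories*, Commun. Math. Phys. **102**,
255–275 (1985) [Balaban1985UV3] (cell paper B10; held `paper:balaban1985-cmp102-uv-stability-3d`, journal page = PDF page
+ 254; p. 262 = [PDF 8] re-read 2026-08-25 on the text layer `p0008.txt`; the displays (23)–(25) are quoted in the forms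
verified on the render by `…B10Eq25Rate`); [5] of the paper = [Balaban1985BackgroundPropagators] (CMP 99) p. 409 (3.90), p. 410.
«…» = verbatim.

HONEST FRAMING.  Kernel bookkeeping of the LATTICE GEOMETRY of [Balaban1985UV3] p. 262 (YM-PLAN Track A, DAG node N08 =
[B10], seat `pub-ymgap-dag-n08-b`, «first missing estimate» lane; second file); finite windows of ℤ^d; Bałaban AS PRINTED
with page locators.  The cluster expansion, its terms and the bound (23) for them are NOT constructed or asserted (they stay
the hypothesis `B10Eq25Rate.WalkTermBound23`); nothing of (41), (5), Theorem 1/2; nothing continuum ∕ mass gap ∕ Clay.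

## The printed text (p. 262 [PDF 8])

«We localize vertices in big blocks by a decomposition of unity, and we expand the propagators C⁽⁰⁾(Ω₁, U₁) into the
generalized random walk expansion described in [5], Theorem 3.15, Theorem 3.10 and the preceding theorems. This gives a sum
of expressions having the following structure. Each expression corresponds to a graph with vertices localized in cubes
{□_j}. A line of the graph connecting vertices □_i, □_j is replaced by a random walk ω = ((α₀, X₀), (α₁, X₁), …,
(αₙ, Xₙ)) satisfying □_i ∩ X₀ ≠ ∅, X_{m−1} ∩ X_m ≠ ∅, m = 1, …, n, X_m ∩ □_j ≠ ∅. A term in the expression, corresponding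
to the walk ω, satisfies the bound (3.108) [5], i.e. can be bounded by O(1)O(M₁^{−(1/2)})^{|ω|}M₁^{−(1/2)|ω|}
exp(−½δ₀d(ω, □_i, □_j)), (23) where d(ω, □_i, □_j) is the length of a shortest tree graph passing through □_i, □_j, {X_m}.
Let us recall that the sets X_m are connected unions of several big blocks. The localizations {□_j} and the walks ω
replacing lines of the graph define a localization X of the considered expression. This localization is simply a union
of all these sets. … Summing the expressions with the same localization X we get finally the inequality (24) … Localizations
X are connected unions of big blocks. Following [19] we define a linear size 𝓛(X) of a localization X as the length of a
shortest tree graph connecting the centers of big blocks in X, and other points, if the big blocks are scaled to unit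
cubes, i.e. the distance between centers of neighbouring blocks is taken to be equal to 1. With this definition we have
|𝒫′₁(g₀, X, U₁)| ≦ O(g₀)e^{−κ𝓛(X)} (25) where κ can be arbitrarily large if M₁ is sufficiently large.»

## Why this file exists (the located missing estimate, second in printed order after `…B10Eq39CollarVolume`)

The cell's kernel edge (23) ⇒ (25) (`B10Eq25Rate.rate25`, `bound25_of_bound23`, pub-balaban GAPS C-b10g12-1) and its
continuation (25) ⇒ «|E^{(j)}| ≤ O(1)|T₁^{(j)}|» of (65) p. 273 (`B10Eq65PolymerSum.norm_total_le_of_bound25`) are typed over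
ABSTRACT carriers: walk states `Q`, anchors `S`, `cube : S → Q`, localization `dom : S → List Q → D.Dom` over a `LocDomainSys`
`D`, a `CubeSystem`; and they carry FOUR geometric hypotheses that the module docstrings record as NOT typed for the paper's
geometry («unions of big blocks are not modelled — DIVERGENCE F5»): the rescaling law `RescaleLaw` (instances (T)/(N) «neither
is typed», C-b10g12-1), the walk-state adjacency count `(nbrs q).card ≤ D𝔤` ([5] p. 410 «We will use the factor O(M^{−1/2})
to control the sum over random walks»), the anchor facts `hV`/`hstart`, and the volume law `B13.VolBoundK1`.  This module
BUILDS the carriers on a finite window `B ⊂ ℤ^d` of big blocks — the cell's concrete localization-domain system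
`TreeLengthCubeSystem.sys B` (domains = non-empty face-connected families of blocks, 𝓛 = the formalised tree length
`TreeLength.treeLen`, «distance between centers of neighbouring blocks … equal to 1») — and PROVES all four.

## What this file proves (kernel, 0 sorry, axioms standard; any dimension d, any window B, any size bound s₀ ≥ 1)

* §1 `State B s₀` — the walk states X_m: «connected unions of several big blocks» = non-empty face-connected families of
  ≤ s₀ blocks of B (finite type, decidable equality); `nbrs` — «X_{m−1} ∩ X_m ≠ ∅» read as SHARING A BLOCK; `single` — the
  one-block states «cubes □_j» anchoring the terms; `cubesQ X` — the one-block states of the blocks of X (the count function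
  of (25)/(65)), `card_cubesQ` (= #blocks of X), `card_anchors_le_one` (V = 1).
* §2 `wunion`, `walk_props` — for every walk ω of `B9Thm37Sum.walksFrom nbrs n □` ([5] (3.90)): the union of its states
  contains □, IS a localization domain (face-connected, by `B13Ineq232.faceConnected_union` along the shared blocks) and has
  ≤ s₀(n + 1) blocks; `domOf` — «This localization is simply a union of all these sets» as an element of `(sys B).Dom`
  (`domOf_val`), `anchor_mem_domOf` (`hstart`); `treeLen_domOf_le` — 𝓛(X) ≤ s₀n + s₀ − 1 (`TreeLength.treeLen_le_card_sub_one`);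
  **`rescaleLaw_window : RescaleLaw (sys B) (nbrs B s₀) (single hs) (domOf hs) wd M 0 s₀ s₀`** — THE COUNT LAW (N) of
  `B10Eq25Rate`'s docstring, for EVERY nonnegative walk distance `wd` (Λ = 0: the law does not use d(ω, □_i, □_j)).
* §3 `animalBound d s₀ = ⌈K₀(4·2^d, 2d)·e^{κ₀(4·2^d, 2d)·s₀}⌉`, `card_states_containing_le` — at most `animalBound` states
  contain a given block (the anchored tree-decay sum (1.26) of [Balaban1988RG2Cluster] for the window,
  `TreeLengthCubeSystem.sum_exp_treeLen_le`, with 𝓛 ≤ s₀ − 1 on states); **`card_nbrs_le : (nbrs q).card ≤ s₀·animalBound d s₀`**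
  — the entropy input D𝔤.
* §4 **`volBoundK1_window`** — `B13.VolBoundK1 (sys B) (#cubesQ) (4·2^d)` from `TreeLengthCubeSystem.volumeLeaf`
  ([Dimock2013BalabanII] App. E Lemma E.1 mechanism, `TreeLength.card_le_treeLen`).
* §5 **`bound25_window`** — `B10Eq25Rate.bound25_of_bound23` with ALL geometric hypotheses discharged: for every rate κ ≥ 0 and
  M₁ ≥ 2·s₀·animalBound·c·e^{κs₀}, the analytic leaf `WalkTermBound23 (sys B) (nbrs B s₀) (single hs) (domOf hs) sp term wd (A₀g) C c M₁ δ₀`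
  ALONE gives (25) `B10.Bound25Printed … g (κ − 1) (2A₀C·e^{κs₀}·4·2^d)` for the regrouped terms `B10LogDet63.Elog`; and
  **`norm_total_window`** — the first clause of (65), `‖Σ_X E_log(X, U)‖ ≤ (2A₀Ce^{κs₀}·4·2^d)·g·K₀(4·2^d, 2d)·#blocks(B)` for
  κ − 1 ≥ κ₀(4·2^d, 2d), by `B10Eq65PolymerSum.norm_total_le_of_bound25` over `TreeLengthCubeSystem.cubeSys B` (`degreeLE`,
  `volumeLeaf` BY NAME).

## What is NOT claimed

(i) The walk terms, the expansion and the bound (23) = [5] (3.108) for them are hypotheses (`WalkTermBound23`; GAPS G-B10-04);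
(ii) «X_{m−1} ∩ X_m ≠ ∅» is read as sharing a big BLOCK (face-connected geometry of `TreeLengthCubeSystem`); contact of closed
blocks along a lower-dimensional face only is not covered (it needs the corner-connected variant of `TreeLength`, not in the
tree) — an expansion organised with that contact can be re-organised by fattening each X_m by its wall-neighbours, at the
price s₀ ↦ (2d + 1)s₀, which this file does not do; (iii) the window is a finite subset of ℤ^d with free boundary (the torus
periodicity of T₁ is not modelled, as in `TreeLengthCubeSystem`); (iv) only the COUNT law (N) is proved; the tube law (T)
(decay rate linear in M₁ from the exponential factor of (23)) is not; with (N) the rate comes from the per-step smallness,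
`B10Eq25Rate.entropy_iff`; (v) d = `d` free (print: d = 3); nothing of (41)/(5).

Cell records: pub-balaban GAPS C-b10g12-1 ((23) → (25) edge; (T)/(N) located, not typed), G-B10-04; DIVERGENCE F5 (cube/tree
geometry abstract), D-b10.16; SKELETON rows B10.Eq23, B10.Eq24, B10.Eq25, B10.Eq65 (lit-balaban); YM-PLAN §2b N08.
-/

noncomputable section

namespace Literature.MathematicalPhysics.QuantumFieldTheory.Balaban1983to89.B10Eq25WalkGeometry

open Literature.MathematicalPhysics.QuantumFieldTheory.Balaban1983to89
open Literature.MathematicalPhysics.QuantumFieldTheory.Balaban1983to89.B13ScaleTransfer (Pt Adj FaceConnected Linked)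
open Literature.MathematicalPhysics.QuantumFieldTheory.Balaban1983to89.TreeLength (treeLen treeLen_le_card_sub_one
  treeLen_nonneg)
open Literature.MathematicalPhysics.QuantumFieldTheory.Balaban1983to89.TreeLengthCubeSystem (IsDom Dom sys Cell cellsOf
  cubeSys mem_cellsOf card_cellsOf sum_exp_treeLen_le degreeLE volumeLeaf cubeSys_vol sys_dj)
open Literature.MathematicalPhysics.QuantumFieldTheory.Balaban1983to89.B12TreeDecay (kappa₀ K₀ kappa₀_nonneg K₀_pos)
open Literature.MathematicalPhysics.QuantumFieldTheory.Balaban1983to89.B13Ineq232 (faceConnected_union)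
open Literature.MathematicalPhysics.QuantumFieldTheory.Balaban1983to89.B10Eq25Rate (WalkTermBound23 RescaleLaw
  activitiesOf bound25_of_bound23)

variable {d : ℕ}

/-! ## §1 The walk states: face-connected unions of at most `s₀` big blocks of the window -/

section States

/-- «the sets X_m are connected unions of several big blocks» (p. 262): a walk state of the window `B` with size bound `s₀`
is a localization domain of the window (`TreeLengthCubeSystem.IsDom`: non-empty, face-connected, inside `B`) with at most `s₀`
blocks. [cite: Balaban1985UV3, p.262] -/
def IsState (B : Finset (Pt d)) (s₀ : ℕ) (X : Finset (Pt d)) : Prop := IsDom B X ∧ X.card ≤ s₀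

/-- The type of walk states X_m of the window («connected unions of several big blocks», p. 262). [cite: Balaban1985UV3, p.262] -/
def State (B : Finset (Pt d)) (s₀ : ℕ) : Type := {X : Finset (Pt d) // IsState B s₀ X}

/-- The walk states of a finite window form a finite type. [folklore] -/
instance instFintypeState (B : Finset (Pt d)) (s₀ : ℕ) : Fintype (State B s₀) := by
  classical
  exact Fintype.subtype (B.powerset.filter fun X => X.Nonempty ∧ FaceConnected X ∧ X.card ≤ s₀) fun X => by
    simp only [Finset.mem_filter, Finset.mem_powerset, IsState, IsDom, and_assoc]

/-- Equality of walk states is decidable. [folklore] -/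
instance instDecidableEqState (B : Finset (Pt d)) (s₀ : ℕ) : DecidableEq (State B s₀) :=
  inferInstanceAs (DecidableEq {X : Finset (Pt d) // IsState B s₀ X})

/-- Equality of localization domains of the window is decidable. [folklore] -/
instance instDecidableEqDom (B : Finset (Pt d)) : DecidableEq (sys B).Dom :=
  inferInstanceAs (DecidableEq {X : Finset (Pt d) // IsDom B X})

/-- A walk state is a localization domain of the window. [cite: Balaban1985UV3, p.262] -/
def State.toDom {B : Finset (Pt d)} {s₀ : ℕ} (q : State B s₀) : (sys B).Dom := ⟨q.1, q.2.1⟩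

/-- «X_{m−1} ∩ X_m ≠ ∅, m = 1, …, n» (p. 262; [5] (3.90) «□ᵢ ∩ □ᵢ₊₁ ≠ ∅»), read as SHARING A BIG BLOCK: the states meeting a
given state, as a finite list (the `nbrs` of `B9Thm37Sum.walksFrom`). [cite: Balaban1985UV3, p.262] -/
def nbrs (B : Finset (Pt d)) (s₀ : ℕ) (q : State B s₀) : Finset (State B s₀) := by
  classical
  exact Finset.univ.filter fun q' => (q.1 ∩ q'.1).Nonempty

/-- Membership in `nbrs`, unfolded. [cite: Balaban1985UV3, p.262] -/
theorem mem_nbrs {B : Finset (Pt d)} {s₀ : ℕ} {q q' : State B s₀} : q' ∈ nbrs B s₀ q ↔ (q.1 ∩ q'.1).Nonempty := by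
  classical
  simp [nbrs]

/-- A single block is a face-connected family. [folklore] -/
private theorem faceConnected_singleton (x : Pt d) : FaceConnected ({x} : Finset (Pt d)) := by
  intro a ha b hb
  rw [Finset.mem_singleton] at ha hb
  subst ha; subst hb
  exact Relation.ReflTransGen.refl

/-- «Each expression corresponds to a graph with vertices localized in cubes {□_j}» (p. 262): the one-block state of a
block of the window — the anchor of a walk term (needs `s₀ ≥ 1`). [cite: Balaban1985UV3, p.262] -/
def single {B : Finset (Pt d)} {s₀ : ℕ} (hs : 1 ≤ s₀) (b : Cell B) : State B s₀ :=
  ⟨{b.1}, ⟨Finset.singleton_subset_iff.mpr b.2, Finset.singleton_nonempty _, faceConnected_singleton b.1⟩,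
    by simpa using hs⟩

/-- The blocks of a one-block state. [cite: Balaban1985UV3, p.262] -/
@[simp] theorem single_val {B : Finset (Pt d)} {s₀ : ℕ} (hs : 1 ≤ s₀) (b : Cell B) : (single hs b).1 = {b.1} := rfl

/-- Distinct blocks give distinct one-block states. [cite: Balaban1985UV3, p.262] -/
theorem single_injective {B : Finset (Pt d)} {s₀ : ℕ} (hs : 1 ≤ s₀) : Function.Injective (single (B := B) hs) := by
  intro b b' h
  have : ({b.1} : Finset (Pt d)) = {b'.1} := congrArg Subtype.val h
  exact Subtype.ext (Finset.singleton_injective this)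

/-- The one-block states of the blocks of a localization domain X — the count function `#cubes(X)` of
`B10Eq25Rate.rate25` / `B13.VolBoundK1` at this carrier. [cite: Balaban1985UV3, p.262] -/
def cubesQ {B : Finset (Pt d)} {s₀ : ℕ} (hs : 1 ≤ s₀) (X : (sys B).Dom) : Finset (State B s₀) :=
  (cellsOf B X.1).image (single hs)

/-- `#cubesQ(X)` is the number of blocks of X. [cite: Balaban1985UV3, p.262] -/
theorem card_cubesQ {B : Finset (Pt d)} {s₀ : ℕ} (hs : 1 ≤ s₀) (X : (sys B).Dom) : (cubesQ hs X).card = X.1.card := by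
  unfold cubesQ
  rw [Finset.card_image_of_injective _ (single_injective hs), card_cellsOf X.2.1]

/-- The one-block state of a block of X lies in `cubesQ X`. [cite: Balaban1985UV3, p.262] -/
theorem single_mem_cubesQ {B : Finset (Pt d)} {s₀ : ℕ} (hs : 1 ≤ s₀) {X : (sys B).Dom} {b : Cell B} (hb : b.1 ∈ X.1) :
    single hs b ∈ cubesQ hs X :=
  Finset.mem_image.mpr ⟨b, (mem_cellsOf).mpr hb, rfl⟩

/-- At most ONE anchor block per state (the count `V = 1` of `B10Eq25Rate.rate25`'s hypothesis `hV`). [cite: Balaban1985UV3, p.262] -/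
theorem card_anchors_le_one {B : Finset (Pt d)} {s₀ : ℕ} (hs : 1 ≤ s₀) (q : State B s₀) :
    (Finset.univ.filter fun b : Cell B => single hs b = q).card ≤ 1 := by
  classical
  refine Finset.card_le_one.mpr fun b hb b' hb' => ?_
  rw [Finset.mem_filter] at hb hb'
  exact single_injective hs (hb.2.trans hb'.2.symm)

end States

/-! ## §2 The localization domain of an anchored walk: the union of its states -/

section Walks

variable {B : Finset (Pt d)} {s₀ : ℕ}

/-- «This localization is simply a union of all these sets» (p. 262): the union of the blocks of the states of a walk. [cite: Balaban1985UV3, p.262] -/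
def wunion : List (State B s₀) → Finset (Pt d)
  | [] => ∅
  | q :: ω => q.1 ∪ wunion ω

/-- The empty walk has no blocks. [cite: Balaban1985UV3, p.262] -/
@[simp] theorem wunion_nil : wunion ([] : List (State B s₀)) = ∅ := rfl

/-- The blocks of a walk with a first state prepended. [cite: Balaban1985UV3, p.262] -/
@[simp] theorem wunion_cons (q : State B s₀) (ω : List (State B s₀)) : wunion (q :: ω) = q.1 ∪ wunion ω := rfl

/-- **The walks of [5] (3.90) through the states** (`B9Thm37Sum.walksFrom nbrs n X₀`: n steps from X₀, consecutive states
sharing a block): the union of the states CONTAINS X₀, IS a localization domain of the window (inside B, non-empty,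
face-connected — `B13Ineq232.faceConnected_union` along the shared blocks) and has at most `s₀(n + 1)` blocks.
[cite: Balaban1985UV3, p.262; Balaban1985BackgroundPropagators, (3.90) p.409] -/
theorem walk_props : ∀ (n : ℕ) (c : State B s₀) (ω : List (State B s₀)),
    ω ∈ B9Thm37Sum.walksFrom (nbrs B s₀) n c →
      c.1 ⊆ wunion ω ∧ IsDom B (wunion ω) ∧ (wunion ω).card ≤ s₀ * (n + 1)
  | 0, c, ω, hω => by
      simp only [B9Thm37Sum.walksFrom, Finset.mem_singleton] at hω
      subst hω
      simp only [wunion_cons, wunion_nil, Finset.union_empty, zero_add, mul_one]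
      exact ⟨subset_rfl, c.2.1, c.2.2⟩
  | n + 1, c, ω, hω => by
      simp only [B9Thm37Sum.walksFrom, Finset.mem_biUnion, Finset.mem_image] at hω
      obtain ⟨c', hc', ω', hω', rfl⟩ := hω
      obtain ⟨hsub, hdom, hcard⟩ := walk_props n c' ω' hω'
      have hmeet : (c.1 ∩ wunion ω').Nonempty := by
        obtain ⟨z, hz⟩ := mem_nbrs.mp hc'
        rw [Finset.mem_inter] at hz
        exact ⟨z, Finset.mem_inter.mpr ⟨hz.1, hsub hz.2⟩⟩
      refine ⟨Finset.subset_union_left, ⟨?_, ?_, ?_⟩, ?_⟩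
      · exact Finset.union_subset c.2.1.1 hdom.1
      · exact ⟨_, Finset.mem_union_left _ (c.2.1.2.1.choose_spec)⟩
      · rw [wunion_cons]
        exact faceConnected_union c.2.1.2.2 hdom.2.2 hmeet
      · rw [wunion_cons]
        calc (c.1 ∪ wunion ω').card ≤ c.1.card + (wunion ω').card := Finset.card_union_le _ _
          _ ≤ s₀ + s₀ * (n + 1) := add_le_add c.2.2 hcard
          _ = s₀ * (n + 1 + 1) := by ring

/-- **The localization X of the term (□, ω)** («This localization is simply a union of all these sets», p. 262) as an
element of the concrete system `TreeLengthCubeSystem.sys B`: the union of the walk's states when it is a localization domain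
containing the anchor block (always the case on the walks of `walksFrom` from the anchor, `domOf_val`), else the anchor
block (junk value making `domOf` total). [cite: Balaban1985UV3, p.262] -/
def domOf (hs : 1 ≤ s₀) (b : Cell B) (ω : List (State B s₀)) : (sys B).Dom := by
  classical
  exact if h : IsDom B (wunion ω) ∧ b.1 ∈ wunion ω then ⟨wunion ω, h.1⟩ else (single hs b).toDom

/-- On the walks of (23) anchored at □ the localization domain IS the union of the states. [cite: Balaban1985UV3, p.262] -/
theorem domOf_val {hs : 1 ≤ s₀} {b : Cell B} {n : ℕ} {ω : List (State B s₀)}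
    (hω : ω ∈ B9Thm37Sum.walksFrom (nbrs B s₀) n (single hs b)) : (domOf hs b ω).1 = wunion ω := by
  classical
  obtain ⟨hsub, hdom, -⟩ := walk_props n (single hs b) ω hω
  have hb : b.1 ∈ wunion ω := hsub (by simp)
  unfold domOf
  rw [dif_pos ⟨hdom, hb⟩]

/-- The anchor block belongs to the localization domain of its terms («□ᵢ ∩ X₀ ≠ ∅», p. 262). [cite: Balaban1985UV3, p.262] -/
theorem anchor_mem_domOf (hs : 1 ≤ s₀) (b : Cell B) (ω : List (State B s₀)) : b.1 ∈ (domOf hs b ω).1 := by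
  classical
  unfold domOf
  split_ifs with h
  · exact h.2
  · show b.1 ∈ ({b.1} : Finset (Pt d))
    exact Finset.mem_singleton_self _

/-- The hypothesis `hstart` of `B10Eq25Rate.rate25` at this carrier: the anchor's one-block state is counted in `cubesQ` of
the term's localization domain. [cite: Balaban1985UV3, p.262] -/
theorem single_mem_cubesQ_domOf (hs : 1 ≤ s₀) (b : Cell B) (n : ℕ) (ω : List (State B s₀))
    (_hω : ω ∈ B9Thm37Sum.walksFrom (nbrs B s₀) n (single hs b)) : single hs b ∈ cubesQ hs (domOf hs b ω) :=
  single_mem_cubesQ hs (anchor_mem_domOf hs b ω)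

/-- The localization domain of an n-step walk term has at most `s₀(n + 1)` blocks. [cite: Balaban1985UV3, p.262] -/
theorem card_domOf_le {hs : 1 ≤ s₀} {b : Cell B} {n : ℕ} {ω : List (State B s₀)}
    (hω : ω ∈ B9Thm37Sum.walksFrom (nbrs B s₀) n (single hs b)) : (domOf hs b ω).1.card ≤ s₀ * (n + 1) := by
  rw [domOf_val hω]
  exact (walk_props n _ ω hω).2.2

/-- **The linear size of a walk's localization** («a linear size 𝓛(X) … if the big blocks are scaled to unit cubes», p. 262):
`𝓛(X(□, ω)) ≤ s₀·|ω| + s₀ − 1` — a face-connected family of m blocks has tree length ≤ m − 1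
(`TreeLength.treeLen_le_card_sub_one`). [cite: Balaban1985UV3, p.262 (before (25))] -/
theorem treeLen_domOf_le {hs : 1 ≤ s₀} {b : Cell B} {n : ℕ} {ω : List (State B s₀)}
    (hω : ω ∈ B9Thm37Sum.walksFrom (nbrs B s₀) n (single hs b)) :
    treeLen (domOf hs b ω).1 ≤ (s₀ : ℝ) * n + ((s₀ : ℝ) - 1) := by
  have hX := (domOf hs b ω).2
  have h1 := treeLen_le_card_sub_one hX.2.1 hX.2.2
  have h2 : ((domOf hs b ω).1.card : ℝ) ≤ (s₀ : ℝ) * (n + 1) := by exact_mod_cast card_domOf_le hω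
  linarith

/-- **THE RESCALING LAW, COUNT FORM (N), PROVED on the window geometry** — the hypothesis `B10Eq25Rate.RescaleLaw` whose
instances the cell recorded as «neither is typed» (GAPS C-b10g12-1): for every nonnegative walk distance `wd` (unused: Λ = 0)
and `M ≥ 0`, `M·𝓛(X(□, ω)) ≤ 0·d(ω, □ᵢ, □ⱼ) + M·(s₀·|ω| + s₀)`. [cite: Balaban1985UV3, p.262 (before (25))] -/
theorem rescaleLaw_window (hs : 1 ≤ s₀) (wd : Cell B → List (State B s₀) → ℝ) (hwd : ∀ b ω, 0 ≤ wd b ω)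
    {M : ℝ} (hM : 0 ≤ M) :
    RescaleLaw (sys B) (nbrs B s₀) (single hs) (domOf hs) wd M 0 s₀ s₀ := by
  intro b n ω hω
  refine ⟨hwd b ω, ?_⟩
  rw [sys_dj, zero_mul, zero_add]
  have h := treeLen_domOf_le hω
  have hs1 : (1 : ℝ) ≤ s₀ := by exact_mod_cast hs
  nlinarith [h, hs1, treeLen_nonneg (domOf hs b ω).1]

end Walks

/-! ## §3 The adjacency count of the walk states (the entropy input «D𝔤» of `B10Eq25Rate.rate25`) -/

section Entropy

variable {B : Finset (Pt d)} {s₀ : ℕ}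

/-- The animal bound of the window geometry: `⌈K₀(4·2^d, 2d)·e^{κ₀(4·2^d, 2d)·s₀}⌉` — a bound for the number of face-connected
families of at most `s₀` blocks containing a given block (from the anchored tree-decay sum (1.26) of [Balaban1988RG2Cluster] for
windows, `TreeLengthCubeSystem.sum_exp_treeLen_le`). [cite: Balaban1988RG2Cluster, (1.26) p.8] -/
def animalBound (d s₀ : ℕ) : ℕ := ⌈K₀ (4 * 2 ^ d) (2 * d) * Real.exp (kappa₀ (4 * 2 ^ d) (2 * d) * s₀)⌉₊

/-- **At most `animalBound d s₀` walk states contain a given block**: their images are face-connected subfamilies X ∋ □ of B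
with 𝓛(X) ≤ |X| − 1 ≤ s₀, each weighing ≥ e^{−κ₀s₀} in the anchored sum `Σ_{X ∋ □} e^{−κ₀𝓛(X)} ≤ K₀` of
`TreeLengthCubeSystem.sum_exp_treeLen_le`. [cite: Balaban1988RG2Cluster, (1.26) p.8; Balaban1985UV3, p.262] -/
theorem card_states_containing_le {c : Pt d} (hc : c ∈ B) :
    (Finset.univ.filter fun q : State B s₀ => c ∈ q.1).card ≤ animalBound d s₀ := by
  classical
  set κ := kappa₀ (4 * 2 ^ d) (2 * d) with hκ
  have hκ0 : 0 ≤ κ := kappa₀_nonneg (by positivity) _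
  -- inject the states containing c into the face-connected subfamilies of B containing c
  let F : Finset (Finset (Pt d)) := B.powerset.filter fun X => c ∈ X ∧ FaceConnected X
  have hsum : ∑ X ∈ F, Real.exp (-κ * treeLen X) ≤ K₀ (4 * 2 ^ d) (2 * d) := sum_exp_treeLen_le B hc le_rfl
  let T : Finset (Finset (Pt d)) := (Finset.univ.filter fun q : State B s₀ => c ∈ q.1).image Subtype.val
  have hTF : T ⊆ F := by
    intro X hX
    obtain ⟨q, hq, rfl⟩ := Finset.mem_image.mp hX
    have hcq : c ∈ q.1 := (Finset.mem_filter.mp hq).2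
    exact Finset.mem_filter.mpr ⟨Finset.mem_powerset.mpr q.2.1.1, hcq, q.2.1.2.2⟩
  have hcardT : T.card = (Finset.univ.filter fun q : State B s₀ => c ∈ q.1).card :=
    Finset.card_image_of_injective _ Subtype.val_injective
  -- each such X has treeLen ≤ s₀, so its weight is ≥ e^{−κ s₀}
  have hlow : ∀ X ∈ T, Real.exp (-κ * s₀) ≤ Real.exp (-κ * treeLen X) := by
    intro X hX
    obtain ⟨q, -, rfl⟩ := Finset.mem_image.mp hX
    have h1 := treeLen_le_card_sub_one q.2.1.2.1 q.2.1.2.2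
    have h2 : (q.1.card : ℝ) ≤ s₀ := by exact_mod_cast q.2.2
    exact Real.exp_le_exp.mpr (by nlinarith)
  have key : (T.card : ℝ) * Real.exp (-κ * s₀) ≤ K₀ (4 * 2 ^ d) (2 * d) :=
    calc (T.card : ℝ) * Real.exp (-κ * s₀) = ∑ _X ∈ T, Real.exp (-κ * s₀) := by
          rw [Finset.sum_const, nsmul_eq_mul]
      _ ≤ ∑ X ∈ T, Real.exp (-κ * treeLen X) := Finset.sum_le_sum hlow
      _ ≤ ∑ X ∈ F, Real.exp (-κ * treeLen X) :=
          Finset.sum_le_sum_of_subset_of_nonneg hTF fun _ _ _ => (Real.exp_pos _).le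
      _ ≤ K₀ (4 * 2 ^ d) (2 * d) := hsum
  have hexp : 0 < Real.exp (-κ * s₀) := Real.exp_pos _
  have hT : (T.card : ℝ) ≤ K₀ (4 * 2 ^ d) (2 * d) * Real.exp (κ * s₀) := by
    have h1 := (le_div_iff₀ hexp).mpr key
    rwa [neg_mul, Real.exp_neg, div_inv_eq_mul] at h1
  rw [← hcardT]
  exact Nat.cast_le.mp ((hT.trans (Nat.le_ceil _)).trans (by simp [animalBound, hκ]))

/-- **THE WALK-STATE ADJACENCY COUNT** (the entropy input «D𝔤» of `B10Eq25Rate.rate25`; [5] p. 410 «We will use the factor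
O(M^{−1/2}) to control the sum over random walks ω»): a state of ≤ s₀ blocks meets at most `s₀·animalBound d s₀` states
(one of its ≤ s₀ blocks is shared). [cite: Balaban1985UV3, p.262; Balaban1985BackgroundPropagators, p.410] -/
theorem card_nbrs_le (q : State B s₀) : (nbrs B s₀ q).card ≤ s₀ * animalBound d s₀ := by
  classical
  have hsub : nbrs B s₀ q ⊆ q.1.biUnion fun c => Finset.univ.filter fun q' : State B s₀ => c ∈ q'.1 := by
    intro q' hq'
    obtain ⟨c, hc⟩ := mem_nbrs.mp hq'
    rw [Finset.mem_inter] at hc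
    exact Finset.mem_biUnion.mpr ⟨c, hc.1, Finset.mem_filter.mpr ⟨Finset.mem_univ _, hc.2⟩⟩
  calc (nbrs B s₀ q).card ≤ (q.1.biUnion fun c => Finset.univ.filter fun q' : State B s₀ => c ∈ q'.1).card :=
        Finset.card_le_card hsub
    _ ≤ ∑ c ∈ q.1, (Finset.univ.filter fun q' : State B s₀ => c ∈ q'.1).card := Finset.card_biUnion_le
    _ ≤ ∑ _c ∈ q.1, animalBound d s₀ :=
        Finset.sum_le_sum fun c hc => card_states_containing_le (q.2.1.1 hc)
    _ = q.1.card * animalBound d s₀ := by rw [Finset.sum_const, smul_eq_mul]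
    _ ≤ s₀ * animalBound d s₀ := Nat.mul_le_mul_right _ q.2.2

end Entropy

/-! ## §4 The volume law for the single-block count function -/

section Volume

variable {B : Finset (Pt d)} {s₀ : ℕ}

/-- **THE VOLUME LAW for the count function of (25)/(65)**: `#cubesQ(X) = #blocks(X) ≤ 4·2^d·(1 + 𝓛(X))` —
`B13.VolBoundK1 (sys B) (#cubesQ) (4·2^d)` from `TreeLengthCubeSystem.volumeLeaf` ([Dimock2013BalabanII] App. E Lemma E.1 (3)
mechanism, `TreeLength.card_le_treeLen`) BY NAME. [cite: Balaban1985UV3, p.262; Dimock2013BalabanII, App. E Lemma E.1] -/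
theorem volBoundK1_window (hs : 1 ≤ s₀) : B13.VolBoundK1 (sys B) (fun X => (cubesQ (s₀ := s₀) hs X).card) (4 * 2 ^ d) := by
  intro X
  have h := volumeLeaf B X
  rw [cubeSys_vol] at h
  show ((cubesQ hs X).card : ℝ) ≤ _
  rw [card_cubesQ]
  exact_mod_cast h

end Volume

/-! ## §5 (23) ⇒ (25) ⇒ the first clause of (65) ON THE WINDOW GEOMETRY — every geometric hypothesis discharged -/

section Assembly

variable {B : Finset (Pt d)} {s₀ : ℕ} {Φ : Type}

/-- **(23) ⇒ (25) ON THE WINDOW OF BIG BLOCKS, every geometric hypothesis discharged** («With this definition we have (25) …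
where κ can be arbitrarily large if M₁ is sufficiently large»): for every rate `κ ≥ 0`, every `M₁ > 0` past the entropy
threshold `2·(s₀·animalBound)·c·e^{κs₀} ≤ M₁` and every `g > 0`, the analytic leaf (23)
`WalkTermBound23 (sys B) (nbrs B s₀) (single hs) (domOf hs) sp term wd (A₀g) C c M₁ δ₀` ALONE gives
`B10.Bound25Printed` for the regrouped terms `B10LogDet63.Elog` with rate `κ − 1` and `O(g₀) = (2A₀C·e^{κs₀}·4·2^d)·g₀` —
`B10Eq25Rate.bound25_of_bound23` with `hD := card_nbrs_le`, `hV := card_anchors_le_one`, `hstart := single_mem_cubesQ_domOf`,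
`hsc := rescaleLaw_window`, `hvol := volBoundK1_window` (Λ = 0, ℓ₀ = ℓ₁ = s₀, V = 1, c₁ = 4·2^d). [cite: Balaban1985UV3, (23)–(25) p.262] -/
theorem bound25_window (hs : 1 ≤ s₀) {sp : (sys B).Dom → Set Φ} {term : Cell B → List (State B s₀) → Φ → ℂ}
    {wd : Cell B → List (State B s₀) → ℝ} (hwd : ∀ b ω, 0 ≤ wd b ω) {A₀ C c M δ₀ κ g : ℝ} {R : Set Φ}
    (hM : 0 < M) (hA₀ : 0 ≤ A₀) (hC : 0 ≤ C) (hc : 0 ≤ c) (hδ₀ : 0 < δ₀) (hκ : 0 ≤ κ) (hg : 0 < g)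
    (hMent : 2 * (((s₀ * animalBound d s₀ : ℕ) : ℝ) * (c * Real.exp (κ * s₀))) ≤ M)
    (h23 : WalkTermBound23 (sys B) (nbrs B s₀) (single hs) (domOf hs) sp term wd (A₀ * g) C c M δ₀)
    (hR : ∀ X, R ⊆ sp X) :
    B10.Bound25Printed (activitiesOf (sys B) (B10LogDet63.Elog (nbrs B s₀) (single hs) (domOf hs) term) R) g (κ - 1)
      (2 * A₀ * C * Real.exp (κ * s₀) * (4 * 2 ^ d)) := by
  have hMκ : 2 * κ * 0 / δ₀ ≤ M := by simp; exact hM.le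
  have h := bound25_of_bound23 (cubes := cubesQ hs) (Dg := s₀ * animalBound d s₀) (V := 1)
    (fun q => card_nbrs_le q) (fun q => card_anchors_le_one hs q)
    (fun b n ω hω => single_mem_cubesQ_domOf hs b n ω hω) hM hA₀ hC hc hδ₀ hκ hg hMκ hMent h23
    (rescaleLaw_window hs wd hwd hM.le) (volBoundK1_window hs) hR
  simpa only [Nat.cast_one, mul_one] using h

/-- **(23) ⇒ THE FIRST CLAUSE OF (65) ON THE WINDOW** («From (25), which holds for arbitrary j, we get easily |E^{(j)}| ≤
O(1)|T₁^{(j)}|», p. 273): under the same hypotheses and `κ − 1 ≥ κ₀(4·2^d, 2d)`, the regrouped terms summed over ALL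
localization domains of the window obey `‖Σ_X E_log(X, U)‖ ≤ (2A₀Ce^{κs₀}·4·2^d)·g·K₀(4·2^d, 2d)·#blocks(B)` at every real
configuration `U ∈ R` — `B10Eq65PolymerSum.norm_total_le_of_bound25` over `TreeLengthCubeSystem.cubeSys B` (`degreeLE B`,
`volumeLeaf B`) BY NAME, fed by `bound25_window`. [cite: Balaban1985UV3, (25) p.262; (65) p.273] -/
theorem norm_total_window (hs : 1 ≤ s₀) {sp : (sys B).Dom → Set Φ} {term : Cell B → List (State B s₀) → Φ → ℂ}
    {wd : Cell B → List (State B s₀) → ℝ} (hwd : ∀ b ω, 0 ≤ wd b ω) {A₀ C c M δ₀ κ g : ℝ} {R : Set Φ}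
    (hM : 0 < M) (hA₀ : 0 ≤ A₀) (hC : 0 ≤ C) (hc : 0 ≤ c) (hδ₀ : 0 < δ₀) (hκ : 0 ≤ κ) (hg : 0 < g)
    (hMent : 2 * (((s₀ * animalBound d s₀ : ℕ) : ℝ) * (c * Real.exp (κ * s₀))) ≤ M)
    (hκ' : kappa₀ (4 * 2 ^ d) (2 * d) ≤ κ - 1)
    (h23 : WalkTermBound23 (sys B) (nbrs B s₀) (single hs) (domOf hs) sp term wd (A₀ * g) C c M δ₀)
    (hR : ∀ X, R ⊆ sp X) (U : R) :
    ‖∑ X : (sys B).Dom, B10LogDet63.Elog (nbrs B s₀) (single hs) (domOf hs) term X (U : Φ)‖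
      ≤ (2 * A₀ * C * Real.exp (κ * s₀) * (4 * 2 ^ d)) * g * K₀ (4 * 2 ^ d) (2 * d) * Fintype.card (Cell B) :=
  B10Eq65PolymerSum.norm_total_le_of_bound25 (cubeSys B) (degreeLE B) (volumeLeaf B) hκ' _ R (by positivity)
    (bound25_window hs hwd hM hA₀ hC hc hδ₀ hκ hg hMent h23 hR) U

end Assembly

end Literature.MathematicalPhysics.QuantumFieldTheory.Balaban1983to89.B10Eq25WalkGeometry

end
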